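import Mathlib
import Summits.ValiantsHypothesis.ValiantsHypothesis.Theses.BarrierLever
import Summits.ValiantsHypothesis.ValiantsHypothesis.Theorems.BarrierLeverPrincipalMinorLayoutsNonsingularRefutation
import Summits.ValiantsHypothesis.ValiantsHypothesis.Theorems.BarrierLeverTransversalSufficesForPrincipal
import Summits.ValiantsHypothesis.ValiantsHypothesis.Theorems.BarrierLeverTransversalMinorLayoutsNonsingularOfTropicalDet
import Summits.ValiantsHypothesis.ValiantsHypothesis.Theorems.BarrierLeverChainCertificatesSufficeForTropicalDet
import Summits.ValiantsHypothesis.ValiantsHypothesis.Theorems.BarrierLeverChainCertificateSufficesHolds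

/-!
# Route BarrierLever — item `ChainCertificatesExist` (stmt-ValiantsHypothesis-19652): REFUTATION

Refutation file (`--workitem stmt-ValiantsHypothesis-19652`; cell valiant-natproofs, rung V4, 𝒟-side;
prover seat val-np-p3 gen 4). Definition-free; a corollary of the refutation of TNS
(`TNSRefutation.not_PrincipalMinorLayoutsNonsingular`, item 19126: at `h = 31` the layout
`u = (∅, {0}, …, {30})`, `w =` all subsets of `{0,…,4}` has a singular principal-minor layout
matrix for EVERY `K`) through arrows already in the tree.

**`not_ChainCertificatesExist`**: chain certificates do NOT exist for every layout, since
`ChainCertificateSuffices → ChainCertificatesExist → TropicalDetCertificatesExist` (item 19653,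
`ChainGlue.chainCertificatesSufficeForTropicalDet`) with 19651 proved, UT-D ⇒ TT, TT ⇒ TNS (19153), and TNS false.

WHAT THIS IS NOT: item 19717 `PartitionMinorsHitByVP` (layout-dependent witnesses) is untouched;
nothing on crux stmt-14610 or `VP` vs `VNP`.
-/

set_option linter.dupNamespace false

namespace Summit.ValiantsHypothesis.ValiantsHypothesis.Theorems.BarrierLever.TNSRefutation

/-- **Chain certificates do not always exist** (item `ChainCertificatesExist`, stmt-ValiantsHypothesis-19652):
by the proved glue 19653 (with 19651), UT-D ⇒ TT, TT ⇒ TNS (19153) and the refutation of TNS. -/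
theorem not_ChainCertificatesExist :
    ¬ Summit.ValiantsHypothesis.ValiantsHypothesis.Theses.BarrierLever.ChainCertificatesExist :=
  fun hC => not_PrincipalMinorLayoutsNonsingular
    (TransversalDictionary.transversalSufficesForPrincipal
      (TropicalDet.transversalMinorLayoutsNonsingular_of_tropicalDetCertificates
        (ChainGlue.chainCertificatesSufficeForTropicalDet ChainCert.chainCertificateSuffices_route hC)))

end Summit.ValiantsHypothesis.ValiantsHypothesis.Theorems.BarrierLever.TNSRefutation
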